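import Mathlib
import Literature.AlgebraicGeometry.Resolution.CobordantGame
import Literature.AlgebraicGeometry.Resolution.CobordantChartCoefficients
import Literature.AlgebraicGeometry.Resolution.CobordantChartPlaneSlice
import Literature.AlgebraicGeometry.Resolution.CobordantTupleGame
import Summits.ResolutionOfSingularities.ResolutionOfSingularities.Theorems.WeightedInvariantLocalWeightedDropWildPurePowerCleanSteps

/-!
# `WeightedInvariant.LocalWeightedDrop`, line `hasse-ridge-face-selection`: the point step at a GENERAL exceptional point is
# the point step at an AXIS point after a linear SHEAR of the plane (Hauser–Perlega's `ρ(y) = x(y + t)`)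

Crux item stmt-ResolutionOfSingularities-8899 `LocalWeightedDrop` (route `ResolutionOfSingularities/WeightedInvariant`),
serving the door `WeightedConstruction` stmt-ResolutionOfSingularities-0571.  [OURS · L1 W4.3, chain w43, stub worker 1
(gen 2): S3πM infrastructure — reduces every successor of `WildPurePower.won_purePower_of_pointStep` to the axis form whose
coefficients `coeff_slice_subst_pointChart_axis₀` computes; HP 2024 §2 p. 774 («after possibly swapping `x` and `y`,
`ρ(x) = x`, `ρ(y) = x(y + t)`»).  Not a statement of any manuscript; elementary.]

* `slice_subst_pointChart_eq_axis₀`: for `c₁ ≠ 0`, the slice `y₁ = 0` of `A ∘ chart(c₁, c₂)` equals the slice of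
  `(A ∘ σ_t) ∘ chart(c₁, 0)` with the linear shear `σ_t = (x₁, x₂ + t x₁)`, `t = c₂ / c₁`;
* `slice_subst_pointChart_eq_axis₁`: the mirror statement for the slot `1` (`c₂ ≠ 0`, shear `(x₁ + t x₂, x₂)`, `t = c₁/c₂`);
* `coeff_slice_subst_pointChart_axis₁`: the axis formula for the slot `1` (`c = (0, c₂)`), mirror of `…axis₀`;
* `isUnit_det_shear` / `constantCoeff_shear`: the shear is a legal plane change (so `won_purePower_substX_iff` applies).
-/

set_option linter.dupNamespace false -- mandated namespace of this single-conjunct summit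

namespace Summit.ResolutionOfSingularities.ResolutionOfSingularities.Theorems

open Literature.AlgebraicGeometry.Resolution

namespace WildPurePower

open MvPowerSeries WildTerminal Literature.AlgebraicGeometry.Resolution.CobordantGame

variable {k : Type} [Field k]

/-! ### The shears of the plane -/

/-- The shear `σ = (x_j + t x_i ↦ …)`: `x_i ↦ x_i`, `x_j ↦ x_j + t · x_i` (`j ≠ i`), as a substitution family. -/
theorem constantCoeff_shear (i : Fin 2) (t : k) (l : Fin 2) :
    constantCoeff ((fun l : Fin 2 => if l = i then (X i : MvPowerSeries (Fin 2) k) else X l + C t * X i) l) = 0 := by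
  dsimp only
  split_ifs
  · exact constantCoeff_X i
  · rw [map_add, map_mul, constantCoeff_X, constantCoeff_X, mul_zero, add_zero]

/-- The shear is substitutable. -/
theorem hasSubst_shear (i : Fin 2) (t : k) :
    HasSubst (fun l : Fin 2 => if l = i then (X i : MvPowerSeries (Fin 2) k) else X l + C t * X i) :=
  hasSubst_of_constantCoeff_zero (constantCoeff_shear i t)

/-- The shear has unipotent linear part. -/
theorem isUnit_det_shear (i : Fin 2) (t : k) :
    IsUnit (FormalCoordChange.linMat (fun l : Fin 2 => if l = i then (X i : MvPowerSeries (Fin 2) k) else X l + C t * X i)).det := by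
  classical
  have hi : i = 0 ∨ i = 1 := by fin_cases i <;> simp
  rcases hi with rfl | rfl
  · rw [Matrix.det_fin_two]
    simp [FormalCoordChange.linMat, coeff_X, Finsupp.single_eq_single_iff]
  · rw [Matrix.det_fin_two]
    simp [FormalCoordChange.linMat, coeff_X, Finsupp.single_eq_single_iff]

/-! ### The point chart followed by the slice, as one substitution -/

/-- The components of `slice i₀ ∘ chart(c)` on the plane variables. -/
theorem slice_pointChart_apply (i₀ : Fin 2) (c : Fin 2 → k) (l : Fin 2) :
    TupleGame.slice i₀ (CobordantChart.chart (fun _ : Fin 2 => 1) c l) =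
      if l = i₀ then C (c l) * X 0 else (X 0 : MvPowerSeries (Fin 2) k) * (C (c l) + X 1) := by
  have hi : i₀ = 0 ∨ i₀ = 1 := by fin_cases i₀ <;> simp
  have hl : l = 0 ∨ l = 1 := by fin_cases l <;> simp
  rcases hi with rfl | rfl <;> rcases hl with rfl | rfl
  · rw [pointChart_zero, slice_mul, slice_add, slice_C, slice_X_zero, slice_zero_X_one, if_pos rfl, add_zero, mul_comm]
  · rw [pointChart_one, slice_mul, slice_add, slice_C, slice_X_zero, slice_zero_X_two, if_neg (by decide)]
  · rw [pointChart_zero, slice_mul, slice_add, slice_C, slice_X_zero, slice_one_X_one, if_neg (by decide)]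
  · rw [pointChart_one, slice_mul, slice_add, slice_C, slice_X_zero, slice_one_X_two, if_pos rfl, add_zero, mul_comm]

/-- `slice i₀ (A ∘ chart(c))` as a single substitution of the plane variables. -/
theorem slice_subst_pointChart_eq_subst (i₀ : Fin 2) (c : Fin 2 → k) (A : MvPowerSeries (Fin 2) k) :
    TupleGame.slice i₀ (subst (CobordantChart.chart (fun _ : Fin 2 => 1) c) A) =
      subst (fun l : Fin 2 => if l = i₀ then C (c l) * X 0 else (X 0 : MvPowerSeries (Fin 2) k) * (C (c l) + X 1)) A := by
  unfold TupleGame.slice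
  rw [subst_comp_subst_apply (hasSubst_pointChart c) (CobordantChartPlaneSlice.hasSubst_slice i₀)]
  congr 1
  funext l
  exact slice_pointChart_apply i₀ c l

/-! ### Reduction of a general exceptional point to an axis point by a shear -/

/-- THE POINT STEP AT `(c₁, c₂)`, SLOT `0` (`c₁ ≠ 0`), IS THE AXIS POINT STEP AT `(c₁, 0)` AFTER THE SHEAR
`x₂ ↦ x₂ + (c₂/c₁) x₁`. -/
theorem slice_subst_pointChart_eq_axis₀ (c : Fin 2 → k) (hc : c 0 ≠ 0) (A : MvPowerSeries (Fin 2) k) :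
    TupleGame.slice (0 : Fin 2) (subst (CobordantChart.chart (fun _ : Fin 2 => 1) c) A) =
      TupleGame.slice (0 : Fin 2) (subst (CobordantChart.chart (fun _ : Fin 2 => 1) (Function.update c 1 0))
        (subst (fun l : Fin 2 => if l = 0 then (X 0 : MvPowerSeries (Fin 2) k) else X l + C (c 1 / c 0) * X 0) A)) := by
  rw [slice_subst_pointChart_eq_subst, slice_subst_pointChart_eq_subst,
    subst_comp_subst_apply (hasSubst_shear 0 _) (hasSubst_of_constantCoeff_zero (fun l => by
      split_ifs
      · rw [map_mul, constantCoeff_C, constantCoeff_X, mul_zero]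
      · rw [map_mul, map_add, constantCoeff_C, constantCoeff_X, zero_mul]))]
  congr 1
  funext l
  have hs := hasSubst_of_constantCoeff_zero (σ := Fin 2) (τ := Fin 2) (a := fun l : Fin 2 =>
    if l = 0 then C (Function.update c 1 0 l) * X 0 else (X 0 : MvPowerSeries (Fin 2) k) * (C (Function.update c 1 0 l) + X 1))
    (fun l => by
      split_ifs
      · rw [map_mul, constantCoeff_C, constantCoeff_X, mul_zero]
      · rw [map_mul, map_add, constantCoeff_C, constantCoeff_X, zero_mul])
  have h10 : (1 : Fin 2) ≠ 0 := by decide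
  have hlcase : l = 0 ∨ l = 1 := by fin_cases l <;> simp
  rcases hlcase with rfl | rfl
  · rw [if_pos rfl, if_pos rfl, subst_X hs, if_pos rfl, Function.update_of_ne h10.symm]
  · rw [if_neg h10, if_neg h10, ← coe_substAlgHom hs, map_add, map_mul, coe_substAlgHom, subst_X hs, subst_X hs, subst_C,
      if_neg h10, if_pos rfl, Function.update_self, Function.update_of_ne h10.symm, map_zero, zero_add,
      show C (c 1) = C (c 1 / c 0) * C (c 0) by rw [← map_mul, div_mul_cancel₀ _ hc]]
    ring

/-- THE MIRROR: the point step at `(c₁, c₂)`, slot `1` (`c₂ ≠ 0`), is the axis point step at `(0, c₂)` after the shear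
`x₁ ↦ x₁ + (c₁/c₂) x₂`. -/
theorem slice_subst_pointChart_eq_axis₁ (c : Fin 2 → k) (hc : c 1 ≠ 0) (A : MvPowerSeries (Fin 2) k) :
    TupleGame.slice (1 : Fin 2) (subst (CobordantChart.chart (fun _ : Fin 2 => 1) c) A) =
      TupleGame.slice (1 : Fin 2) (subst (CobordantChart.chart (fun _ : Fin 2 => 1) (Function.update c 0 0))
        (subst (fun l : Fin 2 => if l = 1 then (X 1 : MvPowerSeries (Fin 2) k) else X l + C (c 0 / c 1) * X 1) A)) := by
  rw [slice_subst_pointChart_eq_subst, slice_subst_pointChart_eq_subst,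
    subst_comp_subst_apply (hasSubst_shear 1 _) (hasSubst_of_constantCoeff_zero (fun l => by
      split_ifs
      · rw [map_mul, constantCoeff_C, constantCoeff_X, mul_zero]
      · rw [map_mul, map_add, constantCoeff_C, constantCoeff_X, zero_mul]))]
  congr 1
  funext l
  have hs := hasSubst_of_constantCoeff_zero (σ := Fin 2) (τ := Fin 2) (a := fun l : Fin 2 =>
    if l = 1 then C (Function.update c 0 0 l) * X 0 else (X 0 : MvPowerSeries (Fin 2) k) * (C (Function.update c 0 0 l) + X 1))
    (fun l => by
      split_ifs
      · rw [map_mul, constantCoeff_C, constantCoeff_X, mul_zero]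
      · rw [map_mul, map_add, constantCoeff_C, constantCoeff_X, zero_mul])
  have h01 : (0 : Fin 2) ≠ 1 := by decide
  have hlcase : l = 0 ∨ l = 1 := by fin_cases l <;> simp
  rcases hlcase with rfl | rfl
  · rw [if_neg h01, if_neg h01, ← coe_substAlgHom hs, map_add, map_mul, coe_substAlgHom, subst_X hs, subst_X hs, subst_C,
      if_neg h01, if_pos rfl, Function.update_self, Function.update_of_ne h01.symm, map_zero, zero_add,
      show C (c 0) = C (c 0 / c 1) * C (c 1) by rw [← map_mul, div_mul_cancel₀ _ hc]]
    ring
  · rw [if_pos rfl, if_pos rfl, subst_X hs, if_pos rfl, Function.update_of_ne h01.symm]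

/-! ### The axis formula for the slot `1` -/

/-- The generic term of the point-chart sum at the axis point `c = (0, c₂)` read through the slice `y₂ = 0`. -/
theorem finsum_pointChart_axis_eq₁ (c₁ : k) (A : MvPowerSeries (Fin 2) k) (r j : ℕ) :
    (∑ᶠ d : Fin 2 →₀ ℕ, if Finsupp.weight (fun _ : Fin 2 => 1) d = r then
        coeff d A * ∏ l, (((d l).choose ((Finsupp.single (0 : Fin 2) j : Fin 2 →₀ ℕ) l) : k) *
          (fun l : Fin 2 => if l = 1 then c₁ else 0) l ^ (d l - (Finsupp.single (0 : Fin 2) j : Fin 2 →₀ ℕ) l))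
      else 0) =
      if j ≤ r then c₁ ^ (r - j) * coeff (Finsupp.single 0 j + Finsupp.single 1 (r - j)) A else 0 := by
  classical
  by_cases hjr : j ≤ r
  · rw [if_pos hjr, finsum_eq_single _ (Finsupp.single 0 j + Finsupp.single 1 (r - j))]
    · rw [ApexFreeOrderDrop.weight_one_eq_degree, if_pos (by
        rw [map_add, Finsupp.degree_single, Finsupp.degree_single]; omega), Fin.prod_univ_two]
      simp [mul_comm]
    · intro d hd
      by_cases hw : Finsupp.weight (fun _ : Fin 2 => 1) d = r
      · rw [if_pos hw]
        rw [ApexFreeOrderDrop.weight_one_eq_degree] at hw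
        have hdeg : d.degree = d 0 + d 1 := by simp [Finsupp.degree_eq_sum, Fin.sum_univ_two]
        have hd0 : d 0 ≠ j := by
          intro h
          apply hd
          ext l
          fin_cases l
          · simp [h]
          · simp; omega
        have hzero : (((d 0).choose ((Finsupp.single (0 : Fin 2) j : Fin 2 →₀ ℕ) 0) : k) *
            (fun l : Fin 2 => if l = 1 then c₁ else 0) 0 ^ (d 0 - (Finsupp.single (0 : Fin 2) j : Fin 2 →₀ ℕ) 0)) = 0 := by
          simp only [Finsupp.single_eq_same, zero_ne_one, if_false]
          rcases lt_or_gt_of_ne hd0 with hlt | hgt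
          · rw [Nat.choose_eq_zero_of_lt hlt, Nat.cast_zero, zero_mul]
          · rw [zero_pow (Nat.sub_ne_zero_of_lt hgt), mul_zero]
        rw [Finset.prod_eq_zero (Finset.mem_univ (0 : Fin 2)) hzero, mul_zero]
      · rw [if_neg hw]
  · rw [if_neg hjr]
    refine finsum_eq_zero_of_forall_eq_zero fun d => ?_
    by_cases hw : Finsupp.weight (fun _ : Fin 2 => 1) d = r
    · rw [if_pos hw]
      rw [ApexFreeOrderDrop.weight_one_eq_degree] at hw
      have hdeg : d.degree = d 0 + d 1 := by simp [Finsupp.degree_eq_sum, Fin.sum_univ_two]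
      have hlt : d 0 < j := by omega
      have hzero : (((d 0).choose ((Finsupp.single (0 : Fin 2) j : Fin 2 →₀ ℕ) 0) : k) *
          (fun l : Fin 2 => if l = 1 then c₁ else 0) 0 ^ (d 0 - (Finsupp.single (0 : Fin 2) j : Fin 2 →₀ ℕ) 0)) = 0 := by
        simp only [Finsupp.single_eq_same]
        rw [Nat.choose_eq_zero_of_lt hlt, Nat.cast_zero, zero_mul]
      rw [Finset.prod_eq_zero (Finset.mem_univ (0 : Fin 2)) hzero, mul_zero]
    · rw [if_neg hw]

/-- THE POINT CHART AT THE AXIS POINT `c = (0, c₂)` FOLLOWED BY THE SLICE `y₂ = 0`, IN COEFFICIENTS: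
`[s^r x₂'^j] (A ∘ chart(c))| = c₂^{r-j} · [x₁^j x₂^{r-j}] A` (and `0` if `j > r`). -/
theorem coeff_slice_subst_pointChart_axis₁ (c : Fin 2 → k) (hc : c 0 = 0) (A : MvPowerSeries (Fin 2) k) (β : Fin 2 →₀ ℕ) :
    coeff β (TupleGame.slice (1 : Fin 2) (subst (CobordantChart.chart (fun _ : Fin 2 => 1) c) A)) =
      if β 1 ≤ β 0 then c 1 ^ (β 0 - β 1) * coeff (Finsupp.single 0 (β 1) + Finsupp.single 1 (β 0 - β 1)) A else 0 := by
  have hcfun : c = fun l : Fin 2 => if l = 1 then c 1 else 0 := by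
    funext l
    fin_cases l
    · simpa using hc
    · simp
  unfold TupleGame.slice
  rw [CobordantChartPlaneSlice.coeff_subst_slice, mapDomain_succAbove_two,
    CobordantChart.coeff_subst_chart _ _ (fun l hl => absurd hl one_ne_zero)]
  conv_lhs => rw [hcfun]
  exact finsum_pointChart_axis_eq₁ (c 1) A (β 0) (β 1)

end WildPurePower

end Summit.ResolutionOfSingularities.ResolutionOfSingularities.Theorems
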